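import Mathlib
import Summits.Ventures.PercRepro2.CutOneFar
import Summits.Ventures.PercRepro2.CutOneFarMarked
import Summits.Ventures.PercRepro2.LeafRowLeaves

/-!
# One of `v`, `b`, `o` alone behind a cut vertex: row (LEAF-½) from the right side
(blind cell PercRepro2, p5 g28; `proofs/P5-OEDGE.md` §38)

typer-1's one-far-mark equivalence (`CutOneFar.Gc_eq_reduced`) transports the covariance form `Gc`
along the map `Ψ` of `CutOneFarConn.lean`: with `z` a cut vertex, the far mark `w` on the left and
the other marks on the right (or at `z`), the law of `Ψ` is the product law of the reduced pendant
graph (`prob_Ψ_preimage`) and `Ψ` transports connectivity between the marks (`conn_marks_iff`).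
The middle Bernstein coefficient `R½` of the leaf step (`LeafStep.Rhalf`) is built from the same
kind of masses — connection events, `Q`, `PDEvent`, `TEvent` between the five marks
`o, a₁, a₂, v, b` — so it is transported too (**`Rhalf_transport_marks'`**, **`Rhalf_eq_reduced`**):
row (LEAF-½) on `G` follows from the row on the reduced pendant graph (**`LeafRow_of_reduced`**).

On the reduced graph the far mark is a LEAF at `z` (`leaf_reduced`), so `LeafRowLeaves.lean` decides
the reduced row from the row at `z` — for each of the three non-root marks alone on the left:

* **`LeafRow_v_behind_cut`** / **`LeafRow_b_behind_cut`** / **`LeafRow_o_behind_cut`**: the row on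
  `G` follows from the row on the reduced graph with the far mark MOVED TO `z` (the attachment
  vertex; the pendant edge stays, irrelevant to that row);
* when the cut vertex is itself one of the other marks, the row on `G` is unconditional for the far
  mark `v` (**`LeafRow_v_behind_mark`**: `z ∈ {a₁, a₂, b, o}`, by the leaf-at-a-mark theorems of
  `LeafAA0Reductions.lean`).

Together with the cut-vertex class theorems for a cut vertex SEPARATING the roots
(`CutLeafRow`, `CutLeafRowAAB`, `CutLeafRowABA`: six of the eight placements; the other two contain
every graph), these say where a counterexample to the row would have to live: `b`, `o`, `v` each in
the block of the roots, or a root alone behind a cut vertex (the pendant-root deformation).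
The left side is arbitrary. Nothing here claims the row in general.
-/

namespace Summit.Ventures.PercRepro2

open CovForm CutVertexM9 CutOneFar LeafStep UnionCluster PendantRoot PendantO LeafHalfCross

namespace LeafRowCutOneFar

/-! ## Transport of `R½` along a connectivity-preserving map, marks only -/

section Transport

variable {V : Type*} {E : Type*} {E' : Type*} [Fintype E] [DecidableEq E] [Fintype E']
  [DecidableEq E'] [Fintype V] [DecidableEq V] {R : Type*} [Field R] [LinearOrder R]
  [IsStrictOrderedRing R]

omit [Fintype V] [DecidableEq V] [LinearOrder R] [IsStrictOrderedRing R] in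
/-- **Transport of `R½`, marks only**: `P_q(A) = P_p(Ψ⁻¹ A)` for every event and `Ψ` transports
connectivity between the five marks ⟹ `R½` is carried along. -/
theorem Rhalf_transport_marks' {q : E → R} {p : E' → R} {ends : E → Sym2 V} {ends' : E' → Sym2 V}
    {Ψ : Config E' → Config E} (hP : ∀ A : Set (Config E), prob q A = prob p (Ψ ⁻¹' A))
    (o a₁ a₂ v b : V)
    (hH : ∀ ω, ∀ x ∈ ({o, a₁, a₂, v, b} : Set V), ∀ z ∈ ({o, a₁, a₂, v, b} : Set V),
      Conn ends (Ψ ω) x z ↔ Conn ends' ω x z) :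
    Rhalf q ends o a₁ a₂ v b = Rhalf p ends' o a₁ a₂ v b := by
  have ho : o ∈ ({o, a₁, a₂, v, b} : Set V) := by simp
  have h1 : a₁ ∈ ({o, a₁, a₂, v, b} : Set V) := by simp
  have h2 : a₂ ∈ ({o, a₁, a₂, v, b} : Set V) := by simp
  have hv : v ∈ ({o, a₁, a₂, v, b} : Set V) := by simp
  have hb : b ∈ ({o, a₁, a₂, v, b} : Set V) := by simp
  simp only [Rhalf, T0, Gc1, mU, mUU, EQbo, EQb3, EQb3o, EQo, EQ3, EQ3o, PDb, PDbo, Do, gap, hP,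
    Set.preimage_inter, preimage_PDEvent_of_mem' hH h1 h2 hv, preimage_TEvent_of_mem' hH h1 h2 hv,
    preimage_TEvent_of_mem' hH h2 h1 hv, preimage_connEvent_of_mem' hH h1 ho,
    preimage_connEvent_of_mem' hH h2 ho, preimage_connEvent_of_mem' hH h1 hb,
    preimage_connEvent_of_mem' hH h2 hb, preimage_connEvent_of_mem' hH h1 hv,
    preimage_connEvent_of_mem' hH h2 hv, preimage_avoidAll_singleton_of_mem' hH h2 h1]

end Transport

/-! ## The one-far-mark equivalence for `R½` -/

section Reduced

variable {V : Type*} {E : Type*} [Fintype E] [DecidableEq E] [Fintype V] [DecidableEq V]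
  {R : Type*} [Field R] [LinearOrder R] [IsStrictOrderedRing R]
variable {ends : E → Sym2 V} {side : E → Bool} {L : Set V} {z : V} {Rt : Set V} {w : V}

omit [Fintype V] [DecidableEq V] [LinearOrder R] [IsStrictOrderedRing R] in
/-- **The one-far-mark equivalence for `R½`**: with `z` a cut vertex, the mark `w` on the left and
the other marks on the right (or at `z`), `R½` on `G` is `R½` on the reduced pendant graph. -/
theorem Rhalf_eq_reduced (h : CutVertex ends side L z Rt) (hw : w ∈ L) (p : E → R)
    (o a₁ a₂ v b : V) (hM : ∀ m ∈ ({o, a₁, a₂, v, b} : Set V), m = w ∨ m ∈ Rt ∨ m = z) :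
    Rhalf p ends o a₁ a₂ v b =
      Rhalf (rweights side p (leftProb ends side z w p)) (rends ends side z w) o a₁ a₂ v b :=
  (Rhalf_transport_marks' (fun A => (prob_Ψ_preimage ends side z w p A).symm) o a₁ a₂ v b
    (fun ω x hx y hy => conn_marks_iff h hw ω (hM x hx) (hM y hy))).symm

omit [Fintype V] [DecidableEq V] [IsStrictOrderedRing R] in
/-- **Row (LEAF-½) on `G` from the row on the reduced pendant graph.** -/
theorem LeafRow_of_reduced (h : CutVertex ends side L z Rt) (hw : w ∈ L) (p : E → R)
    (o a₁ a₂ v b : V) (hM : ∀ m ∈ ({o, a₁, a₂, v, b} : Set V), m = w ∨ m ∈ Rt ∨ m = z)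
    (hred : LeafRow (rweights side p (leftProb ends side z w p)) (rends ends side z w) o a₁ a₂ v b) :
    LeafRow p ends o a₁ a₂ v b := by
  unfold LeafRow at hred ⊢
  rw [Rhalf_eq_reduced h hw p o a₁ a₂ v b hM]
  exact hred

end Reduced

/-! ## A non-root mark alone behind a cut vertex -/

section Behind

variable {V : Type*} {E : Type*} [Fintype E] [DecidableEq E] [Fintype V] [DecidableEq V]
  {R : Type*} [Field R] [LinearOrder R] [IsStrictOrderedRing R]
variable {ends : E → Sym2 V} {side : E → Bool} {L : Set V} {z : V} {Rt : Set V}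

/-- **`v` alone behind a cut vertex `z`**: the row on `G` from the row on the reduced graph with `v`
moved to `z` (the pendant edge of the reduced graph is irrelevant to that row). -/
theorem LeafRow_v_behind_cut (h : CutVertex ends side L z Rt) {p : E → R} (hp : IsProbVec p)
    {o a₁ a₂ v b : V} (hv : v ∈ L) (ho : o ∈ Rt ∨ o = z) (h1 : a₁ ∈ Rt ∨ a₁ = z)
    (h2 : a₂ ∈ Rt ∨ a₂ = z) (hb : b ∈ Rt ∨ b = z)
    (hred : LeafRow (rweights side p (leftProb ends side z v p)) (rends ends side z v) o a₁ a₂ z b) :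
    LeafRow p ends o a₁ a₂ v b := by
  refine LeafRow_of_reduced h hv p o a₁ a₂ v b ?_ ?_
  · intro m hm
    simp only [Set.mem_insert_iff, Set.mem_singleton_iff] at hm
    rcases hm with rfl | rfl | rfl | rfl | rfl
    · exact Or.inr ho
    · exact Or.inr h1
    · exact Or.inr h2
    · exact Or.inl rfl
    · exact Or.inr hb
  · exact LeafRowLeaves.LeafRow_leaf_v_of _ _ (isProbVec_rweights_leftProb ends side z v hp)
      (rends_pendant ends side z v) (leaf_reduced h hv) (far_ne_cut h hv)
      (far_ne_right h hv h1) (far_ne_right h hv h2) (far_ne_right h hv ho).symm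
      (far_ne_right h hv hb).symm hred

omit [Fintype V] in
/-- **`b` alone behind a cut vertex `z`**: the row on `G` from the row on the reduced graph with `b`
moved to `z`. -/
theorem LeafRow_b_behind_cut (h : CutVertex ends side L z Rt) {p : E → R} (hp : IsProbVec p)
    {o a₁ a₂ v b : V} (hb : b ∈ L) (ho : o ∈ Rt ∨ o = z) (h1 : a₁ ∈ Rt ∨ a₁ = z)
    (h2 : a₂ ∈ Rt ∨ a₂ = z) (hv : v ∈ Rt ∨ v = z)
    (hred : LeafRow (rweights side p (leftProb ends side z b p)) (rends ends side z b) o a₁ a₂ v z) :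
    LeafRow p ends o a₁ a₂ v b := by
  refine LeafRow_of_reduced h hb p o a₁ a₂ v b ?_ ?_
  · intro m hm
    simp only [Set.mem_insert_iff, Set.mem_singleton_iff] at hm
    rcases hm with rfl | rfl | rfl | rfl | rfl
    · exact Or.inr ho
    · exact Or.inr h1
    · exact Or.inr h2
    · exact Or.inr hv
    · exact Or.inl rfl
  · exact LeafRowLeaves.LeafRow_leaf_b_of _ _ (isProbVec_rweights_leftProb ends side z b hp)
      (rends_pendant ends side z b) (leaf_reduced h hb) (far_ne_cut h hb)
      (far_ne_right h hb h1) (far_ne_right h hb h2) (far_ne_right h hb ho).symm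
      (far_ne_right h hb hv).symm hred

omit [Fintype V] in
/-- **`o` alone behind a cut vertex `z`**: the row on `G` from the row on the reduced graph with `o`
moved to `z`. -/
theorem LeafRow_o_behind_cut (h : CutVertex ends side L z Rt) {p : E → R} (hp : IsProbVec p)
    {o a₁ a₂ v b : V} (ho : o ∈ L) (h1 : a₁ ∈ Rt ∨ a₁ = z) (h2 : a₂ ∈ Rt ∨ a₂ = z)
    (hv : v ∈ Rt ∨ v = z) (hb : b ∈ Rt ∨ b = z)
    (hred : LeafRow (rweights side p (leftProb ends side z o p)) (rends ends side z o) z a₁ a₂ v b) :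
    LeafRow p ends o a₁ a₂ v b := by
  refine LeafRow_of_reduced h ho p o a₁ a₂ v b ?_ ?_
  · intro m hm
    simp only [Set.mem_insert_iff, Set.mem_singleton_iff] at hm
    rcases hm with rfl | rfl | rfl | rfl | rfl
    · exact Or.inl rfl
    · exact Or.inr h1
    · exact Or.inr h2
    · exact Or.inr hv
    · exact Or.inr hb
  · exact LeafRowLeaves.LeafRow_leaf_o_of _ _ (isProbVec_rweights_leftProb ends side z o hp)
      (rends_pendant ends side z o) (leaf_reduced h ho) (far_ne_cut h ho)
      (far_ne_right h ho h1) (far_ne_right h ho h2) (far_ne_right h ho hb).symm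
      (far_ne_right h ho hv).symm hred

/-- **`v` alone behind a cut vertex that is a MARK**: the row holds outright when the cut vertex is
`a₂`, `a₁`, `b` or `o` (the leaf-at-a-mark theorems on the reduced graph). -/
theorem LeafRow_v_behind_mark (h : CutVertex ends side L z Rt) {p : E → R} (hp : IsProbVec p)
    {o a₁ a₂ v b : V} (hv : v ∈ L) (ho : o ∈ Rt ∨ o = z) (h1 : a₁ ∈ Rt ∨ a₁ = z)
    (h2 : a₂ ∈ Rt ∨ a₂ = z) (hb : b ∈ Rt ∨ b = z) (hz : z = a₂ ∨ z = a₁ ∨ z = b ∨ z = o) :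
    LeafRow p ends o a₁ a₂ v b := by
  refine LeafRow_of_reduced h hv p o a₁ a₂ v b ?_ ?_
  · intro m hm
    simp only [Set.mem_insert_iff, Set.mem_singleton_iff] at hm
    rcases hm with rfl | rfl | rfl | rfl | rfl
    · exact Or.inr ho
    · exact Or.inr h1
    · exact Or.inr h2
    · exact Or.inl rfl
    · exact Or.inr hb
  · have hp' := isProbVec_rweights_leftProb ends side z v hp
    have hf := rends_pendant ends side z v
    have hleaf := leaf_reduced h hv
    have h1' := far_ne_right h hv h1
    have h2' := far_ne_right h hv h2
    have ho' := (far_ne_right h hv ho).symm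
    have hb' := (far_ne_right h hv hb).symm
    rcases hz with rfl | rfl | rfl | rfl
    · exact LeafHalfCross.LeafRow_leaf_root _ _ hp' hf hleaf h1' h2' ho' hb'
    · exact LeafHalfCross.LeafRow_leaf_root' _ _ hp' hf hleaf h1' h2' ho' hb'
    · exact LeafHalfCross.LeafRow_leaf_b _ _ hp' hf hleaf h1' h2' ho' hb'
    · exact LeafHalfCross.LeafRow_leaf_o _ _ hp' hf hleaf h1' h2' ho' hb'

end Behind

end LeafRowCutOneFar

end Summit.Ventures.PercRepro2
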